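import Summits.CriticalPhenomena.PercolationContinuityZ3.Theorems.PercNearOneGluingNoHeavyLowerTailSahiCoveringTriplePattern
import Summits.CriticalPhenomena.PercolationContinuityZ3.Theorems.PercNearOneGluingNoHeavyLowerTailE3GroupSepAlphaGlueRows
import HarnessLib

/-!
# `NoHeavyLowerTail` (crux stmt-CriticalPhenomena-4575), master-family line P2: every E3GRP row IS the whole Sahi hierarchy
# of its event algebra — unconditionally all orders for the hybrid/group three-point family and the four decreasing
# five-terminal rows; `RowHolds i ⇒ all orders` for the five increasing rows

Support file (seat `prim-masterthm-p2`, gen 2; `--supports stmt-CriticalPhenomena-4575`); no named fact, no sorry; nothing open is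
claimed.  Instances of `…SahiCoveringTriplePattern.lean` (`P7.sahiPositive_pat_iff_of_isLowerSet / _of_isUpperSet`: for three
same-direction monotone events with `B ⊆ A ∪ C` under a product measure, Sahi positivity of EVERY order on the pattern algebra
⟺ the single cubic `E₃(A,B,C) ≥ 0`).

* `sahiPositive_hybrid` — for every finite weighted graph, vertex `c` and vertex sets `P₁`, `P₃ ⊆ P₃'`, the pattern weight of
  `({P₁ ≁ c}, {P₁ ≁ P₃'}, {c ≁ P₃})` is Sahi-positive of EVERY order: covering relation `{P₁ ≁ P₃'} ⊆ {P₁ ≁ c} ∪ {c ≁ P₃}`, cubic =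
  the hybrid/group three-point lower bound `HybridThreePointLB.sahiE3_hybrid_nonneg` (prim-ineq-gen-8 / prim-cert-2, a THEOREM);
  contains the prequel's 3-point corollary and (prim-bnk-1's dictionary check) all 43 decreasing rows of the E3GRP-77 bank.
* `sahiPositive_row_dec` — the four DECREASING five-terminal rows `r0–r3` of `E3GroupSepCert.row` (every `n`, weight, tuple): all
  orders, unconditionally (`rowHolds_dec`); the coverings `cover_row0 … cover_row8` are two-line reachability arguments.
* `sahiPositive_row_inc_of_rowHolds` — the five INCREASING rows `r4–r8`: `RowHolds i w t →` all orders on the row's pattern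
  algebra (the rows themselves are open in the tree — `T_inc, α, β` have machine-checked switching certificates, INEQ-CLAIMS —
  and follow from `TIncRow ∧ GammaRow ∧ AlphaRow` by `rowHolds_of_generators`; nothing about them is claimed here);
  `sahiPositive_row_of_generators`: `TIncRow → GammaRow → AlphaRow →` all orders on all
  nine row algebras.
* `sahiPositive_alpha_iff / _of_alphaRow`, `sahiPositive_beta_iff / _of_betaRow` — the four-point classes `α`, `β` (any finite
  vertex type): all orders on their pattern algebras ⟺ the row (`AlphaRow`, `BetaRow` as stated in the tree; both have
  machine-checked 4-copy switching certificates, prim-ineq-prove-3 g6, Lean replays pending — nothing claimed here).  The class `γ`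
  is the prequel `sahiPositive_patGamma_iff`, the 3-point rows are `sahiPositive_pat3` / `sahiPositive_pat3inc_iff`.
So for each row: Sahi's conjecture of every order on the row's algebra IS the row's single cubic (memo SAHI-ROUTE.md §4.6–4.8).
-/

noncomputable section

namespace Summit.CriticalPhenomena.PercolationContinuityZ3.Theorems.SahiDeltaSystem

open Finset Function MeasureTheory Literature.Combinatorics.Sahi2008
open Literature.Probability.LatticeModels (prodBernoulli sahiE3 sahiE3_comm₁₂ sahiE3_comm₂₃)
open Literature.Probability.Percolation
open P7

/-! ## The hybrid / group three-point family (any vertex type) -/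

section Hybrid

variable {V : Type*} [Fintype V]

omit [Fintype V] in
/-- Covering relation of the hybrid family: `{P₁ ≁ P₃'} ⊆ {P₁ ≁ c} ∪ {c ≁ P₃}` when `P₃ ⊆ P₃'` (if some `u ∈ P₁` reaches `c`
and `c` reaches some `v ∈ P₃ ⊆ P₃'`, then `u` reaches `v`). [this work] -/
theorem cover_hybrid (c : V) {P₁ P₃ P₃' : Finset V} (hP : P₃ ⊆ P₃') :
    {ω : BondConfig V | ∀ v ∈ P₃', ∀ u ∈ P₁, ω ∉ openConn v u} ⊆
      {ω | ∀ u ∈ P₁, ω ∉ openConn c u} ∪ {ω | ∀ v ∈ P₃, ω ∉ openConn c v} := by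
  intro ω hω
  by_contra h
  simp only [Set.mem_union, Set.mem_setOf_eq, not_or, not_forall, not_not] at h
  obtain ⟨⟨u, hu, hcu⟩, ⟨v, hv, hcv⟩⟩ := h
  exact hω v (hP hv) u hu (SimpleGraph.Reachable.trans (SimpleGraph.Reachable.symm hcv) hcu)

/-- **All orders for the hybrid/group three-point family.**  For every finite weighted graph, vertex `c` and vertex sets
`P₁`, `P₃ ⊆ P₃'`, the pattern weight of the three decreasing events `{P₁ ≁ c}, {P₁ ≁ P₃'}, {c ≁ P₃}` (middle one covered) is
Sahi-positive of EVERY order — from `HybridThreePointLB.sahiE3_hybrid_nonneg`. [this work] -/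
theorem sahiPositive_hybrid (w : Sym2 V → unitInterval) (c : V) (P₁ P₃ P₃' : Finset V) (hP : P₃ ⊆ P₃') (n : ℕ) :
    SahiPositive (pushWeight (bernoulliWeight w) (pat {ω : BondConfig V | ∀ u ∈ P₁, ω ∉ openConn c u}
      {ω | ∀ v ∈ P₃', ∀ u ∈ P₁, ω ∉ openConn v u} {ω | ∀ v ∈ P₃, ω ∉ openConn c v})) n := by
  have hA : IsLowerSet {ω : BondConfig V | ∀ u ∈ P₁, ω ∉ openConn c u} :=
    fun ω ω' hle hω u hu hr => hω u hu (isUpperSet_openConn c u hle hr)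
  have hB : IsLowerSet {ω : BondConfig V | ∀ v ∈ P₃', ∀ u ∈ P₁, ω ∉ openConn v u} :=
    fun ω ω' hle hω v hv u hu hr => hω v hv u hu (isUpperSet_openConn v u hle hr)
  have hC : IsLowerSet {ω : BondConfig V | ∀ v ∈ P₃, ω ∉ openConn c v} :=
    fun ω ω' hle hω v hv hr => hω v hv (isUpperSet_openConn c v hle hr)
  refine (sahiPositive_pat_iff_of_isLowerSet w hA hB hC (cover_hybrid c hP)).2 ?_ n
  rw [sahiE3_comm₂₃]
  exact HybridThreePointLB.sahiE3_hybrid_nonneg w c P₁ P₃ P₃' hP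

/-- Spelled out: `E_n(f₀ ∘ pat, …) ≥ 0` under the percolation weight for every `n` and all nonnegative monotone `f_i : P7 → ℝ`
(nonnegative functions of the pattern of `{P₁ ≁ c}, {P₁ ≁ P₃'}, {c ≁ P₃}`, decreasing in the configuration). [this work] -/
theorem sahiE_hybridPattern_nonneg (w : Sym2 V → unitInterval) (c : V) (P₁ P₃ P₃' : Finset V) (hP : P₃ ⊆ P₃') {n : ℕ}
    (f : Fin n → P7 → ℝ) (hf0 : ∀ i x, 0 ≤ f i x) (hmono : ∀ i, Monotone (f i)) :
    0 ≤ sahiE (bernoulliWeight w) n fun i => f i ∘ pat {ω : BondConfig V | ∀ u ∈ P₁, ω ∉ openConn c u}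
      {ω | ∀ v ∈ P₃', ∀ u ∈ P₁, ω ∉ openConn v u} {ω | ∀ v ∈ P₃, ω ∉ openConn c v} := by
  rw [← sahiE_pushWeight]; exact sahiPositive_hybrid w c P₁ P₃ P₃' hP n f hf0 hmono

end Hybrid

/-! ## The four-point classes `α` and `β` (any finite vertex type) -/

section FourPoint

variable {V : Type*} [Fintype V]

omit [Fintype V] in
/-- Covering relation of the class `α = (U[a|bc], U[ab|c], U[acy|b])`: `U[ab|c] ⊆ U[a|bc] ∪ U[acy|b]`. [this work] -/
theorem cover_alpha (a b c y : V) :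
    {ω : BondConfig V | ∃ x ∈ ({a, b} : Set V), ∃ z ∈ ({c} : Set V), (openGraph ω).Reachable x z} ⊆
      {ω | ∃ x ∈ ({a} : Set V), ∃ z ∈ ({b, c} : Set V), (openGraph ω).Reachable x z} ∪
        {ω | ∃ x ∈ ({a, c, y} : Set V), ∃ z ∈ ({b} : Set V), (openGraph ω).Reachable x z} := by
  rintro ω ⟨x, hx, z, hz, hr⟩
  simp only [Set.mem_insert_iff, Set.mem_singleton_iff] at hx hz
  subst hz
  rcases hx with rfl | rfl
  · exact Or.inl ⟨x, by simp, z, by simp, hr⟩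
  · exact Or.inr ⟨z, by simp, x, by simp, hr.symm⟩

omit [Fintype V] in
/-- Covering relation of the class `β = (U[a|bcy], U[ab|cy], U[acy|b])`: `U[ab|cy] ⊆ U[a|bcy] ∪ U[acy|b]`. [this work] -/
theorem cover_beta (a b c y : V) :
    {ω : BondConfig V | ∃ x ∈ ({a, b} : Set V), ∃ z ∈ ({c, y} : Set V), (openGraph ω).Reachable x z} ⊆
      {ω | ∃ x ∈ ({a} : Set V), ∃ z ∈ ({b, c, y} : Set V), (openGraph ω).Reachable x z} ∪
        {ω | ∃ x ∈ ({a, c, y} : Set V), ∃ z ∈ ({b} : Set V), (openGraph ω).Reachable x z} := by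
  rintro ω ⟨x, hx, z, hz, hr⟩
  simp only [Set.mem_insert_iff, Set.mem_singleton_iff] at hx hz
  rcases hx with rfl | rfl
  · exact Or.inl ⟨x, by simp, z, by rcases hz with rfl | rfl <;> simp, hr⟩
  · exact Or.inr ⟨z, by rcases hz with rfl | rfl <;> simp, x, by simp, hr.symm⟩

/-- **Class `α`: all orders ⟺ the row** (every finite weighted graph, vertices `a b c y`). [this work] -/
theorem sahiPositive_alpha_iff (w : Sym2 V → unitInterval) (a b c y : V) :
    (∀ n, SahiPositive (pushWeight (bernoulliWeight w)
        (pat {ω : BondConfig V | ∃ x ∈ ({a} : Set V), ∃ z ∈ ({b, c} : Set V), (openGraph ω).Reachable x z}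
          {ω | ∃ x ∈ ({a, b} : Set V), ∃ z ∈ ({c} : Set V), (openGraph ω).Reachable x z}
          {ω | ∃ x ∈ ({a, c, y} : Set V), ∃ z ∈ ({b} : Set V), (openGraph ω).Reachable x z})) n) ↔
      0 ≤ sahiE3 (prodBernoulli w)
        {ω : BondConfig V | ∃ x ∈ ({a} : Set V), ∃ z ∈ ({b, c} : Set V), (openGraph ω).Reachable x z}
        {ω | ∃ x ∈ ({a, b} : Set V), ∃ z ∈ ({c} : Set V), (openGraph ω).Reachable x z}
        {ω | ∃ x ∈ ({a, c, y} : Set V), ∃ z ∈ ({b} : Set V), (openGraph ω).Reachable x z} :=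
  sahiPositive_pat_iff_of_isUpperSet w (isUpperSet_groupConn _ _) (isUpperSet_groupConn _ _) (isUpperSet_groupConn _ _)
    (cover_alpha a b c y)

/-- `AlphaRow ⇒` all orders on the `α`-algebra of every finite weighted graph. [this work] -/
theorem sahiPositive_alpha_of_alphaRow (hA : AlphaRow) (V : Type) [Fintype V] (w : Sym2 V → unitInterval) (a b c y : V)
    (n : ℕ) : SahiPositive (pushWeight (bernoulliWeight w)
        (pat {ω : BondConfig V | ∃ x ∈ ({a} : Set V), ∃ z ∈ ({b, c} : Set V), (openGraph ω).Reachable x z}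
          {ω | ∃ x ∈ ({a, b} : Set V), ∃ z ∈ ({c} : Set V), (openGraph ω).Reachable x z}
          {ω | ∃ x ∈ ({a, c, y} : Set V), ∃ z ∈ ({b} : Set V), (openGraph ω).Reachable x z})) n :=
  (sahiPositive_alpha_iff w a b c y).2 (hA V w a b c y) n

/-- **Class `β`: all orders ⟺ the row** (every finite weighted graph, vertices `a b c y`). [this work] -/
theorem sahiPositive_beta_iff (w : Sym2 V → unitInterval) (a b c y : V) :
    (∀ n, SahiPositive (pushWeight (bernoulliWeight w)
        (pat {ω : BondConfig V | ∃ x ∈ ({a} : Set V), ∃ z ∈ ({b, c, y} : Set V), (openGraph ω).Reachable x z}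
          {ω | ∃ x ∈ ({a, b} : Set V), ∃ z ∈ ({c, y} : Set V), (openGraph ω).Reachable x z}
          {ω | ∃ x ∈ ({a, c, y} : Set V), ∃ z ∈ ({b} : Set V), (openGraph ω).Reachable x z})) n) ↔
      0 ≤ sahiE3 (prodBernoulli w)
        {ω : BondConfig V | ∃ x ∈ ({a} : Set V), ∃ z ∈ ({b, c, y} : Set V), (openGraph ω).Reachable x z}
        {ω | ∃ x ∈ ({a, b} : Set V), ∃ z ∈ ({c, y} : Set V), (openGraph ω).Reachable x z}
        {ω | ∃ x ∈ ({a, c, y} : Set V), ∃ z ∈ ({b} : Set V), (openGraph ω).Reachable x z} :=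
  sahiPositive_pat_iff_of_isUpperSet w (isUpperSet_groupConn _ _) (isUpperSet_groupConn _ _) (isUpperSet_groupConn _ _)
    (cover_beta a b c y)

/-- `BetaRow ⇒` all orders on the `β`-algebra of every finite weighted graph. [this work] -/
theorem sahiPositive_beta_of_betaRow (hB : BetaRow) (V : Type) [Fintype V] (w : Sym2 V → unitInterval) (a b c y : V)
    (n : ℕ) : SahiPositive (pushWeight (bernoulliWeight w)
        (pat {ω : BondConfig V | ∃ x ∈ ({a} : Set V), ∃ z ∈ ({b, c, y} : Set V), (openGraph ω).Reachable x z}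
          {ω | ∃ x ∈ ({a, b} : Set V), ∃ z ∈ ({c, y} : Set V), (openGraph ω).Reachable x z}
          {ω | ∃ x ∈ ({a, c, y} : Set V), ∃ z ∈ ({b} : Set V), (openGraph ω).Reachable x z})) n :=
  (sahiPositive_beta_iff w a b c y).2 (hB V w a b c y) n

end FourPoint

/-! ## The nine five-terminal E3GRP rows -/

section Rows

open CovTransferCert E3GroupSepCert

variable {n : ℕ}

/-- Reachability in a configuration is symmetric (membership form). [this work] -/
private theorem conn_symm {ω : BondConfig (Fin n)} {x y : Fin n} (h : ω ∈ openConn x y) : ω ∈ openConn y x :=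
  SimpleGraph.Reachable.symm h
/-- Reachability in a configuration is transitive (membership form). [this work] -/
private theorem conn_trans {ω : BondConfig (Fin n)} {x y z : Fin n} (h₁ : ω ∈ openConn x y) (h₂ : ω ∈ openConn y z) :
    ω ∈ openConn x z := SimpleGraph.Reachable.trans h₁ h₂

/-- Row 0 `(D[a₁a₂|a₃], D[ob|a₁a₂], D[ob|a₃])`: the middle event is covered. [this work] -/
theorem cover_row0 (o a₁ a₂ a₃ b : Fin n) :
    connEvent (sep [o, b] [a₁, a₂]) ⊆ connEvent (sep [a₁, a₂] [a₃]) ∪ connEvent (sep [o, b] [a₃]) := by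
  intro ω hB
  rw [connEvent_sep] at hB
  by_contra h
  simp only [Set.mem_union, connEvent_sep, Set.mem_setOf_eq, not_or, not_forall, not_not] at h
  obtain ⟨⟨x, hx, y, hy, hxy⟩, ⟨u, hu, v, hv, huv⟩⟩ := h
  simp only [List.mem_cons, List.not_mem_nil, or_false] at hy hv
  subst hy; subst hv
  exact hB u hu x hx (conn_trans huv (conn_symm hxy))

/-- Row 1 `(D[o|a₁], D[o|a₂a₃], D[a₁|a₂a₃])`: the middle event is covered. [this work] -/
theorem cover_row1 (o a₁ a₂ a₃ : Fin n) :
    connEvent (sep [o] [a₂, a₃]) ⊆ connEvent (sep [o] [a₁]) ∪ connEvent (sep [a₁] [a₂, a₃]) := by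
  intro ω hB
  rw [connEvent_sep] at hB
  by_contra h
  simp only [Set.mem_union, connEvent_sep, Set.mem_setOf_eq, not_or, not_forall, not_not] at h
  obtain ⟨⟨x, hx, y, hy, hxy⟩, ⟨u, hu, v, hv, huv⟩⟩ := h
  simp only [List.mem_cons, List.not_mem_nil, or_false] at hy hu
  subst hy; subst hu
  exact hB x hx v hv (conn_trans hxy huv)

/-- Row 2 `(D[a₁|a₂a₃], D[a₁|b], D[a₂a₃|b])`: the FIRST event is covered by the other two. [this work] -/
theorem cover_row2 (a₁ a₂ a₃ b : Fin n) :
    connEvent (sep [a₁] [a₂, a₃]) ⊆ connEvent (sep [a₁] [b]) ∪ connEvent (sep [a₂, a₃] [b]) := by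
  intro ω hA
  rw [connEvent_sep] at hA
  by_contra h
  simp only [Set.mem_union, connEvent_sep, Set.mem_setOf_eq, not_or, not_forall, not_not] at h
  obtain ⟨⟨x, hx, y, hy, hxy⟩, ⟨u, hu, v, hv, huv⟩⟩ := h
  simp only [List.mem_cons, List.not_mem_nil, or_false] at hy hv
  subst hy; subst hv
  exact hA x hx u hu (conn_trans hxy (conn_symm huv))

/-- Row 3 `(D[a₁|b], D[a₂a₃|b], D[oa₂a₃|a₁])`: the THIRD event is covered by the other two. [this work] -/
theorem cover_row3 (o a₁ a₂ a₃ b : Fin n) :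
    connEvent (sep [o, a₂, a₃] [a₁]) ⊆ connEvent (sep [a₁] [b]) ∪ connEvent (sep [a₂, a₃] [b]) := by
  intro ω hC
  rw [connEvent_sep] at hC
  by_contra h
  simp only [Set.mem_union, connEvent_sep, Set.mem_setOf_eq, not_or, not_forall, not_not] at h
  obtain ⟨⟨x, hx, y, hy, hxy⟩, ⟨u, hu, v, hv, huv⟩⟩ := h
  simp only [List.mem_cons, List.not_mem_nil, or_false] at hx hy hu hv
  subst hx; subst hy; subst hv
  exact hC u (by rcases hu with rfl | rfl <;> simp) x (by simp) (conn_trans huv (conn_symm hxy))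

/-- Row 4 `(U[oa₁|a₂a₃], U[oa₂|a₁a₃], U[oa₃|a₁a₂])` (`γ`): the middle event is covered. [this work] -/
theorem cover_row4 (o a₁ a₂ a₃ : Fin n) :
    connEvent (lnk [o, a₂] [a₁, a₃]) ⊆ connEvent (lnk [o, a₁] [a₂, a₃]) ∪ connEvent (lnk [o, a₃] [a₁, a₂]) := by
  intro ω hB
  simp only [Set.mem_union, connEvent_lnk, Set.mem_setOf_eq, List.mem_cons, List.not_mem_nil, or_false,
    exists_eq_or_imp, exists_eq_left] at hB ⊢
  rcases hB with (h | h) | (h | h)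
  · exact Or.inr (Or.inl (Or.inl h))
  · exact Or.inl (Or.inl (Or.inr h))
  · exact Or.inl (Or.inr (Or.inl (conn_symm h)))
  · exact Or.inr (Or.inr (Or.inr (conn_symm h)))

/-- Row 5 `(U[ob|a₁a₂a₃], U[oa₁a₂b|a₃], U[oa₃b|a₁a₂])`: the middle event is covered. [this work] -/
theorem cover_row5 (o a₁ a₂ a₃ b : Fin n) :
    connEvent (lnk [o, a₁, a₂, b] [a₃]) ⊆ connEvent (lnk [o, b] [a₁, a₂, a₃]) ∪ connEvent (lnk [o, a₃, b] [a₁, a₂]) := by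
  intro ω hB
  simp only [Set.mem_union, connEvent_lnk, Set.mem_setOf_eq, List.mem_cons, List.not_mem_nil, or_false,
    exists_eq_or_imp, exists_eq_left] at hB ⊢
  rcases hB with h | h | h | h
  · exact Or.inl (Or.inl (Or.inr (Or.inr h)))
  · exact Or.inr (Or.inr (Or.inl (Or.inl (conn_symm h))))
  · exact Or.inr (Or.inr (Or.inl (Or.inr (conn_symm h))))
  · exact Or.inl (Or.inr (Or.inr (Or.inr h)))

/-- Row 6 `(U[oa₁|a₂a₃b], U[oa₃|a₁a₂b], U[oa₂b|a₁a₃])`: the middle event is covered. [this work] -/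
theorem cover_row6 (o a₁ a₂ a₃ b : Fin n) :
    connEvent (lnk [o, a₃] [a₁, a₂, b]) ⊆ connEvent (lnk [o, a₁] [a₂, a₃, b]) ∪ connEvent (lnk [o, a₂, b] [a₁, a₃]) := by
  intro ω hB
  simp only [Set.mem_union, connEvent_lnk, Set.mem_setOf_eq, List.mem_cons, List.not_mem_nil, or_false,
    exists_eq_or_imp, exists_eq_left] at hB ⊢
  rcases hB with (h | h | h) | (h | h | h)
  · exact Or.inr (Or.inl (Or.inl h))
  · exact Or.inl (Or.inl (Or.inl h))
  · exact Or.inl (Or.inl (Or.inr (Or.inr h)))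
  · exact Or.inl (Or.inr (Or.inr (Or.inl (conn_symm h))))
  · exact Or.inr (Or.inr (Or.inl (Or.inr (conn_symm h))))
  · exact Or.inr (Or.inr (Or.inr (Or.inr (conn_symm h))))

/-- Row 7 `(U[o|a₁a₂a₃b], U[oa₁|a₂a₃], U[oa₂a₃|a₁])`: the middle event is covered. [this work] -/
theorem cover_row7 (o a₁ a₂ a₃ b : Fin n) :
    connEvent (lnk [o, a₁] [a₂, a₃]) ⊆ connEvent (lnk [o] [a₁, a₂, a₃, b]) ∪ connEvent (lnk [o, a₂, a₃] [a₁]) := by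
  intro ω hB
  simp only [Set.mem_union, connEvent_lnk, Set.mem_setOf_eq, List.mem_cons, List.not_mem_nil, or_false,
    exists_eq_or_imp, exists_eq_left] at hB ⊢
  rcases hB with (h | h) | (h | h)
  · exact Or.inl (Or.inr (Or.inl h))
  · exact Or.inl (Or.inr (Or.inr (Or.inl h)))
  · exact Or.inr (Or.inr (Or.inl (conn_symm h)))
  · exact Or.inr (Or.inr (Or.inr (conn_symm h)))

/-- Row 8 `(U[a₁|a₂a₃b], U[oa₁a₂a₃|b], U[a₁b|a₂a₃])`: the FIRST event is covered by the other two. [this work] -/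
theorem cover_row8 (o a₁ a₂ a₃ b : Fin n) :
    connEvent (lnk [a₁] [a₂, a₃, b]) ⊆ connEvent (lnk [o, a₁, a₂, a₃] [b]) ∪ connEvent (lnk [a₁, b] [a₂, a₃]) := by
  intro ω hA
  simp only [Set.mem_union, connEvent_lnk, Set.mem_setOf_eq, List.mem_cons, List.not_mem_nil, or_false,
    exists_eq_or_imp, exists_eq_left] at hA ⊢
  rcases hA with h | h | h
  · exact Or.inr (Or.inl (Or.inl h))
  · exact Or.inr (Or.inl (Or.inr h))
  · exact Or.inl (Or.inr (Or.inl h))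

/-- The three events of row `i` at tuple `t`, ORDERED so that the middle one is covered by the other two (rows `2, 8`: first two
slots swapped; row `3`: last two slots swapped; `E₃` is symmetric). [this work] -/
def rowEv (i : Fin 9) (t : Tup n) : Set (BondConfig (Fin n)) × Set (BondConfig (Fin n)) × Set (BondConfig (Fin n)) :=
  match i with
  | 2 => (connEvent (row 2 t).2.1, connEvent (row 2 t).1, connEvent (row 2 t).2.2)
  | 3 => (connEvent (row 3 t).1, connEvent (row 3 t).2.2, connEvent (row 3 t).2.1)
  | 8 => (connEvent (row 8 t).2.1, connEvent (row 8 t).1, connEvent (row 8 t).2.2)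
  | i => (connEvent (row i t).1, connEvent (row i t).2.1, connEvent (row i t).2.2)

/-- The pattern map of row `i` at tuple `t`. [this work] -/
def patRow (i : Fin 9) (t : Tup n) : BondConfig (Fin n) → P7 := pat (rowEv i t).1 (rowEv i t).2.1 (rowEv i t).2.2

/-- The cubic of `rowEv i t` is the row's `E₃` (symmetry of `E₃` in its slots). [this work] -/
theorem sahiE3_rowEv (i : Fin 9) (w : Sym2 (Fin n) → unitInterval) (t : Tup n) :
    sahiE3 (prodBernoulli w) (rowEv i t).1 (rowEv i t).2.1 (rowEv i t).2.2 =
      sahiE3 (prodBernoulli w) (connEvent (row i t).1) (connEvent (row i t).2.1) (connEvent (row i t).2.2) := by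
  fin_cases i
  · rfl
  · rfl
  · exact sahiE3_comm₁₂ _ _ _ _
  · exact sahiE3_comm₂₃ _ _ _ _
  · rfl
  · rfl
  · rfl
  · rfl
  · exact sahiE3_comm₁₂ _ _ _ _

/-- The covering relation of every row (middle slot of `rowEv`). [this work] -/
theorem cover_rowEv (i : Fin 9) (t : Tup n) : (rowEv i t).2.1 ⊆ (rowEv i t).1 ∪ (rowEv i t).2.2 := by
  obtain ⟨o, a₁, a₂, a₃, b⟩ := t
  fin_cases i
  · exact cover_row0 o a₁ a₂ a₃ b
  · exact cover_row1 o a₁ a₂ a₃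
  · exact cover_row2 a₁ a₂ a₃ b
  · exact cover_row3 o a₁ a₂ a₃ b
  · exact cover_row4 o a₁ a₂ a₃
  · exact cover_row5 o a₁ a₂ a₃ b
  · exact cover_row6 o a₁ a₂ a₃ b
  · exact cover_row7 o a₁ a₂ a₃ b
  · exact cover_row8 o a₁ a₂ a₃ b

/-- The decreasing rows' events are decreasing. [this work] -/
theorem isLowerSet_rowEv (i : Fin 9) (hi : i.val ≤ 3) (t : Tup n) :
    IsLowerSet (rowEv i t).1 ∧ IsLowerSet (rowEv i t).2.1 ∧ IsLowerSet (rowEv i t).2.2 := by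
  obtain ⟨o, a₁, a₂, a₃, b⟩ := t
  fin_cases i
  · exact ⟨isLowerSet_connEvent_sep _ _, isLowerSet_connEvent_sep _ _, isLowerSet_connEvent_sep _ _⟩
  · exact ⟨isLowerSet_connEvent_sep _ _, isLowerSet_connEvent_sep _ _, isLowerSet_connEvent_sep _ _⟩
  · exact ⟨isLowerSet_connEvent_sep _ _, isLowerSet_connEvent_sep _ _, isLowerSet_connEvent_sep _ _⟩
  · exact ⟨isLowerSet_connEvent_sep _ _, isLowerSet_connEvent_sep _ _, isLowerSet_connEvent_sep _ _⟩
  all_goals (exfalso; simp at hi)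

/-- The increasing rows' events are increasing. [this work] -/
theorem isUpperSet_rowEv (i : Fin 9) (hi : 4 ≤ i.val) (t : Tup n) :
    IsUpperSet (rowEv i t).1 ∧ IsUpperSet (rowEv i t).2.1 ∧ IsUpperSet (rowEv i t).2.2 := by
  obtain ⟨o, a₁, a₂, a₃, b⟩ := t
  fin_cases i
  · exfalso; simp at hi
  · exfalso; simp at hi
  · exfalso; simp at hi
  · exfalso; simp at hi
  all_goals exact ⟨isUpperSet_connEvent_lnk _ _, isUpperSet_connEvent_lnk _ _, isUpperSet_connEvent_lnk _ _⟩

/-- **Decreasing rows: all orders ⟺ the row** (and the row is a theorem). [this work] -/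
theorem sahiPositive_row_dec_iff (i : Fin 9) (hi : i.val ≤ 3) (w : Sym2 (Fin n) → unitInterval) (t : Tup n) :
    (∀ m, SahiPositive (pushWeight (bernoulliWeight w) (patRow i t)) m) ↔ RowHolds i w t := by
  obtain ⟨hA, hB, hC⟩ := isLowerSet_rowEv i hi t
  unfold patRow RowHolds; rw [sahiPositive_pat_iff_of_isLowerSet w hA hB hC (cover_rowEv i t), sahiE3_rowEv, e3Ineq_iff_sahiE3_nonneg]

/-- **All orders on the pattern algebra of each DECREASING five-terminal E3GRP row, unconditionally**: for every `n`, every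
weight, every terminal tuple and every order `m`, the pattern weight of row `i ≤ 3` is Sahi-positive of order `m`
(`rowHolds_dec` + the covering-triple theorem). [this work] -/
theorem sahiPositive_row_dec (i : Fin 9) (hi : i.val ≤ 3) (w : Sym2 (Fin n) → unitInterval) (t : Tup n) (m : ℕ) :
    SahiPositive (pushWeight (bernoulliWeight w) (patRow i t)) m :=
  (sahiPositive_row_dec_iff i hi w t).2 (rowHolds_dec i hi w t) m

/-- Spelled out for the decreasing rows: `E_m(f₀ ∘ patRow, …) ≥ 0` for all nonnegative monotone `f_j : P7 → ℝ`. [this work] -/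
theorem sahiE_rowPattern_dec_nonneg (i : Fin 9) (hi : i.val ≤ 3) (w : Sym2 (Fin n) → unitInterval) (t : Tup n) {m : ℕ}
    (f : Fin m → P7 → ℝ) (hf0 : ∀ j x, 0 ≤ f j x) (hmono : ∀ j, Monotone (f j)) :
    0 ≤ sahiE (bernoulliWeight w) m fun j => f j ∘ patRow i t := by
  rw [← sahiE_pushWeight]; exact sahiPositive_row_dec i hi w t m f hf0 hmono

/-- **Increasing rows: all orders ⟺ the row.**  For `i ≥ 4` the row (open in the tree; `T_inc, α, β` are machine-certified,
`γ` open) is equivalent to Sahi positivity of every order on its pattern algebra. [this work] -/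
theorem sahiPositive_row_inc_iff (i : Fin 9) (hi : 4 ≤ i.val) (w : Sym2 (Fin n) → unitInterval) (t : Tup n) :
    (∀ m, SahiPositive (pushWeight (bernoulliWeight w) (patRow i t)) m) ↔ RowHolds i w t := by
  obtain ⟨hA, hB, hC⟩ := isUpperSet_rowEv i hi t
  unfold patRow RowHolds; rw [sahiPositive_pat_iff_of_isUpperSet w hA hB hC (cover_rowEv i t), sahiE3_rowEv, e3Ineq_iff_sahiE3_nonneg]

/-- `RowHolds i ⇒` all orders, increasing rows. [this work] -/
theorem sahiPositive_row_inc_of_rowHolds (i : Fin 9) (hi : 4 ≤ i.val) (w : Sym2 (Fin n) → unitInterval) (t : Tup n)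
    (h : RowHolds i w t) (m : ℕ) : SahiPositive (pushWeight (bernoulliWeight w) (patRow i t)) m :=
  (sahiPositive_row_inc_iff i hi w t).2 h m
/-- **All nine rows from the three generators**: `TIncRow → GammaRow → AlphaRow →` Sahi positivity of every order on the pattern
algebra of every five-terminal E3GRP row (rows `0–3` need no hypothesis). [this work] -/
theorem sahiPositive_row_of_generators (hT : TIncRow) (hG : GammaRow) (hA : AlphaRow) (i : Fin 9)
    (w : Sym2 (Fin n) → unitInterval) (t : Tup n) (m : ℕ) : SahiPositive (pushWeight (bernoulliWeight w) (patRow i t)) m := by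
  by_cases hi : i.val ≤ 3
  · exact sahiPositive_row_dec i hi w t m
  · exact sahiPositive_row_inc_of_rowHolds i (by omega) w t (CoSunflowerGlue.rowHolds_of_generators hT hG hA i w t) m

end Rows

end Summit.CriticalPhenomena.PercolationContinuityZ3.Theorems.SahiDeltaSystem

end
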